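import Summits.Parity.GeneralizedHardyLittlewood.Theorems.LeeYangFibresPrimeCellsRelativeChowlaDefs
import Summits.Parity.GeneralizedHardyLittlewood.Theorems.LeeYangFibresAbsoluteUpgradeSinglesDecayRemainder
import Summits.Parity.GeneralizedHardyLittlewood.Theorems.LeeYangFibresAbsoluteUpgradeSinglesDecayThresholds
import Literature.NumberTheory.Sieve.LinearEquationsInPrimesSingularSeries
import Literature.NumberTheory.Sieve.LinearEquationsInPrimesCrudeBounds
import Mathlib.NumberTheory.ArithmeticFunction.Liouville
import HarnessLib

/-!
# Route `LeeYangFibres`, crux `PrimeCellsRelative` (stmt-Parity-14112), line `SketchIdeator4`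
# (card `sieve-out-to-chowla`): the stub `stub_singletonClassSums` — the `|S| = 1` class sums are small

`SingletonClassSums` (vocabulary file `Theorems/LeeYangFibresPrimeCellsRelativeChowlaDefs.lean`): for every
`t, L` there are `C ≥ 0` and `N₀` such that for `N ≥ N₀`, every non-degenerate one-dimensional system `Ψ` of
`t` forms with `‖Ψ‖_N ≤ L`, every integer interval `[m₁, m₂] ⊆ [−N, N]` on which all forms are `≥ 1`, and
every `i`,

  `Σ_{d ≤ N^{1/8} squarefree} Σ_{s mod d, d ∣ F_Ψ(s)} |Σ_{m ∈ [m₁,m₂], m ≡ s (d)} λ(ψ_i(m))| ≤ C N/(log N)^{t+1}`.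

Proof: on `[m₁, m₂]` the singleton tuple sign `σ_{{i}}(m) = (−1)^{Ω(ψ_i(m))}` IS `λ(a_i m + b_i)`
(`ψ_i(m) = a_i m + b_i ≥ 1`), so the left side is at most the sibling line's remainder functional
`Σ_d Σ_s (1 + |Σ_{m ≡ s (d)} λ(a_i m + b_i)|)`, bounded by its landed Bombieri–Vinogradov estimate
`Theorems.AbsoluteUpgrade.classSums_le` (root counts `ω_F(p) ≤ L + t`) at the scale `x = (2L+1)N`:
the values are `≤ 2LN ≤ x` on `[−N, N]`, the moduli satisfy `|a_i| ⌊N^{1/8}⌋ ≤ L N^{1/8} ≤ N^{1/4} ≤ x^{1/4}`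
once `N^{1/8} ≥ L`, and `C₀ x/(log x)^{t+3} ≤ C₀ (2L+1) N/(log N)^{t+1}` once `log N ≥ 1`.

References: H. Iwaniec, E. Kowalski, *Analytic Number Theory* (2004), Thm. 17.4 (Bombieri–Vinogradov for
`λ`) [IwaniecKowalski2004]; H. Halberstam, H.-E. Richert, *Sieve Methods* (1974), §5.7 [HalberstamRichert1974].
-/

noncomputable section

open scoped BigOperators Classical
open Finset Filter

namespace Summit.Parity.GeneralizedHardyLittlewood.Cruxes.PrimeCellsRelative.SieveOutToChowla

open Literature.NumberTheory.Sieve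
open Summit.Parity.GeneralizedHardyLittlewood.Theorems.AbsoluteUpgrade

/-! ### The `|S| = 1` class sums: Bombieri–Vinogradov for `λ` along one form -/

/-- On an interval where the form `ψ_i` is `≥ 1`, the singleton class sum `F_{{i}}([m₁,m₂]; d, r)` is the
Liouville sum `Σ_{m ∈ [m₁,m₂], m ≡ r (d)} λ(a_i m + b_i)`. [folklore] -/
theorem classSum_singleton_eq_liouville {t : ℕ} (Ψ : Fin t → AffLinForm 1) (i : Fin t) {m₁ m₂ : ℤ}
    (hpos : ∀ m ∈ Finset.Icc m₁ m₂, 1 ≤ (Ψ i).eval (fun _ => m)) (d : ℕ) (r : ℤ) :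
    classSum Ψ {i} m₁ m₂ d r =
      ∑ m ∈ (Finset.Icc m₁ m₂).filter (fun m : ℤ => m ≡ r [ZMOD d]),
        (ArithmeticFunction.liouville ((Ψ i).coeff 0 * m + (Ψ i).const).toNat : ℝ) := by
  -- adapted from `Theorems.AbsoluteUpgrade.roughTuples_sum_eq` (sibling line, crux AbsoluteUpgrade)
  unfold classSum tupleSign
  refine Finset.sum_congr rfl fun m hm => ?_
  rw [Finset.mem_filter] at hm
  rw [Finset.prod_singleton]
  have h1 := hpos m hm.1
  have hev : (Ψ i).eval (fun _ => m) = (Ψ i).coeff 0 * m + (Ψ i).const := by rw [DimOne.eval_eq]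
  have hne : ((Ψ i).coeff 0 * m + (Ψ i).const).toNat ≠ 0 := by rw [← hev]; omega
  rw [hev, ArithmeticFunction.liouville_apply hne]
  push_cast
  rfl

/-- The singleton root-class sums are dominated by the sibling line's remainder functional
`Σ_d Σ_s (1 + |Σ_{m ≡ s (d)} λ(a_i m + b_i)|)`. [folklore] -/
theorem rootClassSums_singleton_le {t : ℕ} (Ψ : Fin t → AffLinForm 1) (i : Fin t) {m₁ m₂ : ℤ}
    (hpos : ∀ m ∈ Finset.Icc m₁ m₂, 1 ≤ (Ψ i).eval (fun _ => m)) (D : ℕ) :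
    rootClassSums Ψ {i} m₁ m₂ D ≤
      ∑ d ∈ (Finset.Icc 1 D).filter Squarefree, ∑ s ∈ rootsMod (sysPoly Ψ) d,
        (1 + |∑ m ∈ (Finset.Icc m₁ m₂).filter (fun m : ℤ => m ≡ (s : ℤ) [ZMOD d]),
          (ArithmeticFunction.liouville ((Ψ i).coeff 0 * m + (Ψ i).const).toNat : ℝ)|) := by
  unfold rootClassSums
  refine Finset.sum_le_sum fun d _ => Finset.sum_le_sum fun s _ => ?_
  rw [classSum_singleton_eq_liouville Ψ i hpos d (s : ℤ)]
  linarith [abs_nonneg (∑ m ∈ (Finset.Icc m₁ m₂).filter (fun m : ℤ => m ≡ (s : ℤ) [ZMOD d]),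
    (ArithmeticFunction.liouville ((Ψ i).coeff 0 * m + (Ψ i).const).toNat : ℝ))]

/-- The values of a form of a system of size `≤ L` on `[−N, N]` are `≤ 2LN` (`N ≥ 1`). [folklore] -/
theorem eval_le_two_mul_of_affLinSize_le {t : ℕ} {Ψ : Fin t → AffLinForm 1} {N L : ℕ} (hN : 1 ≤ N)
    (hL : affLinSize Ψ N ≤ L) (i : Fin t) {m : ℤ} (hm : m ∈ Finset.Icc (-(N : ℤ)) N) :
    (((Ψ i).coeff 0 * m + (Ψ i).const : ℤ) : ℝ) ≤ 2 * L * N := by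
  have hbox : (fun _ : Fin 1 => m) ∈ latticeBox 1 N := Fintype.mem_piFinset.mpr fun _ => hm
  have h := abs_eval_le_of_affLinSize_le (L := (L : ℝ)) hN hL hbox i
  rw [DimOne.eval_eq] at h
  exact (le_abs_self _).trans h

/-- The level: `|a_i| ⌊N^{1/8}⌋ ≤ ((2L+1)N)^{1/4}` once `N^{1/8} ≥ L ≥ |a_i|`. [folklore] -/
theorem natAbs_mul_floor_le_rpow {a : ℤ} {L N : ℕ} (haL : a.natAbs ≤ L)
    (hL8 : (L : ℝ) ≤ (N : ℝ) ^ ((1 : ℝ) / 8)) :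
    ((a.natAbs * ⌊(N : ℝ) ^ ((1 : ℝ) / 8)⌋₊ : ℕ) : ℝ) ≤ ((2 * L + 1) * N : ℝ) ^ (1 / 4 : ℝ) := by
  have hN0 : (0 : ℝ) ≤ N := Nat.cast_nonneg N
  have h8 : 0 ≤ (N : ℝ) ^ ((1 : ℝ) / 8) := Real.rpow_nonneg hN0 _
  have hfloor : ((⌊(N : ℝ) ^ ((1 : ℝ) / 8)⌋₊ : ℕ) : ℝ) ≤ (N : ℝ) ^ ((1 : ℝ) / 8) := Nat.floor_le h8
  have ha : ((a.natAbs : ℕ) : ℝ) ≤ L := by exact_mod_cast haL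
  have hsq : (N : ℝ) ^ ((1 : ℝ) / 8) * (N : ℝ) ^ ((1 : ℝ) / 8) = (N : ℝ) ^ (1 / 4 : ℝ) := by
    rw [← Real.rpow_add' hN0 (by norm_num)]; norm_num
  have hNx : (N : ℝ) ≤ (2 * L + 1) * N := by nlinarith [Nat.cast_nonneg (α := ℝ) L]
  calc ((a.natAbs * ⌊(N : ℝ) ^ ((1 : ℝ) / 8)⌋₊ : ℕ) : ℝ)
      = ((a.natAbs : ℕ) : ℝ) * ((⌊(N : ℝ) ^ ((1 : ℝ) / 8)⌋₊ : ℕ) : ℝ) := by rw [Nat.cast_mul]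
    _ ≤ (L : ℝ) * (N : ℝ) ^ ((1 : ℝ) / 8) := mul_le_mul ha hfloor (Nat.cast_nonneg _) (Nat.cast_nonneg _)
    _ ≤ (N : ℝ) ^ ((1 : ℝ) / 8) * (N : ℝ) ^ ((1 : ℝ) / 8) := mul_le_mul_of_nonneg_right hL8 h8
    _ = (N : ℝ) ^ (1 / 4 : ℝ) := hsq
    _ ≤ ((2 * L + 1) * N : ℝ) ^ (1 / 4 : ℝ) := Real.rpow_le_rpow hN0 hNx (by norm_num)

/-- The final comparison of scales: `C₀ x/(log x)^{t+3} ≤ C₀ x/(log N)^{t+1}` for `x ≥ N`, `log N ≥ 1`,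
`C₀ ≥ 0`. [folklore] -/
theorem mul_div_log_pow_le_of_le {C₀ x : ℝ} {N : ℕ} (t : ℕ) (hC : 0 ≤ C₀) (hx : (N : ℝ) ≤ x)
    (hlog : 1 ≤ Real.log N) :
    C₀ * x / Real.log x ^ (t + 3) ≤ C₀ * x / Real.log N ^ (t + 1) := by
  have hN0 : (0 : ℝ) < N := by
    by_contra h
    push Not at h
    have : (N : ℝ) = 0 := le_antisymm h (Nat.cast_nonneg N)
    rw [this, Real.log_zero] at hlog
    linarith
  have hx0 : 0 < x := lt_of_lt_of_le hN0 hx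
  have hlogx : Real.log N ≤ Real.log x := Real.log_le_log hN0 hx
  have hL0 : 0 < Real.log N := by linarith
  have h1 : Real.log N ^ (t + 1) ≤ Real.log N ^ (t + 3) := pow_le_pow_right₀ hlog (by omega)
  have h2 : Real.log N ^ (t + 3) ≤ Real.log x ^ (t + 3) := pow_le_pow_left₀ hL0.le hlogx _
  have hnum : 0 ≤ C₀ * x := mul_nonneg hC hx0.le
  exact div_le_div_of_nonneg_left hnum (pow_pos hL0 _) (h1.trans h2)

/-- **The `|S| = 1` class sums are small** (registered stub `stub_singletonClassSums` of stmt-Parity-14112,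
line `SketchIdeator4`): Bombieri–Vinogradov for `λ` along one form of the system, i.e. the sibling line's
landed `classSums_le` at the scale `x = (2L+1)N` (values `≤ 2LN`, moduli `|a_i| d ≤ L N^{1/8} ≤ x^{1/4}`,
root counts `ω_F(p) ≤ L + t`), the `λ`-sums being the singleton class sums on an interval where the
system is `≥ 1`. [cite: IwaniecKowalski2004, Thm. 17.4] -/
theorem stub_singletonClassSums : SingletonClassSums := by
  intro t L
  obtain ⟨C₀, x₀, hcs⟩ := classSums_le (L + t) t
  set C₁ : ℝ := max C₀ 0 with hC₁
  have hC₁0 : 0 ≤ C₁ := le_max_right _ _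
  obtain ⟨N₀, hN₀⟩ := Filter.eventually_atTop.1 (eventually_basic.and ((eventually_ge_real x₀).and
    (eventually_rpow_ge (L : ℝ) (by norm_num : (0 : ℝ) < 1 / 8))))
  refine ⟨C₁ * (2 * L + 1), by positivity, N₀, fun N hN Ψ hΨ hL m₁ m₂ hI hpos i => ?_⟩
  obtain ⟨⟨hN16, hlog1⟩, hNx₀, hL8⟩ := hN₀ N hN
  have hN1 : 1 ≤ N := by exact_mod_cast (show (1 : ℝ) ≤ N by linarith)
  have hN0 : (0 : ℝ) < N := by exact_mod_cast hN1
  have hlog0 : 0 < Real.log N := by linarith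
  -- the data of the form `ψ_i = a m + b`
  set a : ℤ := (Ψ i).coeff 0 with ha_def
  set b : ℤ := (Ψ i).const with hb_def
  have ha : a ≠ 0 := coeff_ne_zero_of_nondegenerate hΨ i
  have haL : ∀ k, ((Ψ k).coeff 0).natAbs ≤ L := fun k => natAbs_coeff_le_of_affLinSize_le hL k 0
  have hF : ∀ p : ℕ, p.Prime → polyRootCountMod ![sysPoly Ψ] p ≤ L + t := fun p hp =>
    rootCount_le_add hΨ haL hp
  have hev : ∀ m : ℤ, (Ψ i).eval (fun _ => m) = a * m + b := fun m => by rw [DimOne.eval_eq]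
  have hposI : ∀ m ∈ Finset.Icc m₁ m₂, 1 ≤ (Ψ i).eval (fun _ => m) := fun m hm => hpos m hm i
  have hpos' : ∀ m ∈ Finset.Icc m₁ m₂, 1 ≤ a * m + b := fun m hm => by rw [← hev]; exact hposI m hm
  -- the scale `x = (2L+1) N`
  set x : ℝ := (2 * L + 1) * N with hx_def
  have hNx : (N : ℝ) ≤ x := by rw [hx_def]; nlinarith [Nat.cast_nonneg (α := ℝ) L]
  have hx₀ : x₀ ≤ x := hNx₀.trans hNx
  have hlex : ∀ m ∈ Finset.Icc m₁ m₂, ((a * m + b : ℤ) : ℝ) ≤ x := fun m hm => by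
    have h := eval_le_two_mul_of_affLinSize_le hN1 hL i (hI hm)
    rw [hx_def]
    nlinarith [h, Nat.cast_nonneg (α := ℝ) N]
  have hDn : ((a.natAbs * ⌊(N : ℝ) ^ ((1 : ℝ) / 8)⌋₊ : ℕ) : ℝ) ≤ x ^ (1 / 4 : ℝ) :=
    natAbs_mul_floor_le_rpow (haL i) hL8
  -- the right-hand side is non-negative
  have hRHS : 0 ≤ C₁ * (2 * L + 1) * N / Real.log N ^ (t + 1) := by positivity
  rcases lt_or_ge m₂ m₁ with hm | hm
  · -- empty interval
    have h0 : rootClassSums Ψ {i} m₁ m₂ ⌊(N : ℝ) ^ ((1 : ℝ) / 8)⌋₊ = 0 := by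
      simp [rootClassSums, classSum, Finset.Icc_eq_empty_of_lt hm]
    rw [h0]
    exact hRHS
  · have hbound := hcs x hx₀ (sysPoly Ψ) hF a b m₁ m₂ ha hm hpos' hlex _ hDn
    calc rootClassSums Ψ {i} m₁ m₂ ⌊(N : ℝ) ^ ((1 : ℝ) / 8)⌋₊
        ≤ ∑ d ∈ (Finset.Icc 1 ⌊(N : ℝ) ^ ((1 : ℝ) / 8)⌋₊).filter Squarefree, ∑ s ∈ rootsMod (sysPoly Ψ) d,
            (1 + |∑ m ∈ (Finset.Icc m₁ m₂).filter (fun m : ℤ => m ≡ (s : ℤ) [ZMOD d]),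
              (ArithmeticFunction.liouville (a * m + b).toNat : ℝ)|) :=
          rootClassSums_singleton_le Ψ i hposI _
      _ ≤ C₀ * x / Real.log x ^ (t + 3) := hbound
      _ ≤ C₁ * x / Real.log x ^ (t + 3) := by
          refine div_le_div_of_nonneg_right (mul_le_mul_of_nonneg_right (le_max_left _ _) ?_) ?_
          · linarith
          · exact pow_nonneg (hlog0.le.trans (Real.log_le_log hN0 hNx)) _
      _ ≤ C₁ * x / Real.log N ^ (t + 1) := mul_div_log_pow_le_of_le t hC₁0 hNx hlog1
      _ = C₁ * (2 * L + 1) * N / Real.log N ^ (t + 1) := by rw [hx_def]; ring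

end Summit.Parity.GeneralizedHardyLittlewood.Cruxes.PrimeCellsRelative.SieveOutToChowla

end
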